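import Literature.MathematicalPhysics.QuantumLattice.HeisenbergGroundStateSymmetry
import Literature.MathematicalPhysics.QuantumLattice.LiebMattisMatrixElements
import Literature.MathematicalPhysics.QuantumLattice.HeisenbergOrderNeelShortRange
import Literature.MathematicalPhysics.QuantumLattice.SpinChainsAkltCorrelationProofs
import Literature.MathematicalPhysics.QuantumLattice.SpinHalfCasimirBound
import Literature.Probability.LatticeModels.TorusBipartite
import Literature.Probability.LatticeModels.GaussianDomination
import HarnessLib

/-!
# Marshall's sign rule for ground-state correlations, and the energy floor on the Néel sum

Topic `MathematicalPhysics/QuantumLattice` (family `hubbard`); sibling proof file (theorems only,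
no definitions, no named facts) of `HeisenbergGroundStateSymmetry.lean` (uniqueness of the ground
state and Marshall's sign rule in the `Sᶻ = 0` sector,
`LiebMattis.groundState_mem_sector_and_marshall`) and of `HeisenbergOrderNeelShortRange.lean`
(isotropy `⟨𝐒_x·𝐒_y⟩ = 3⟨Sᶻ_xSᶻ_y⟩` and the energy sum rule `E₀ = Σ_edges ⟨𝐒_x·𝐒_y⟩`,
Kennedy–Lieb–Shastry 1988, eq. (3)).

For the spin-`n/2` Heisenberg antiferromagnet `H = J Σ_{edges} 𝐒_x·𝐒_y`, `J > 0`, on a finite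
connected graph bipartite in `A`, `Aᶜ` with `|A| = |Aᶜ|`:

* `LiebMattis.re_dotProduct_spinDot_mulVec_le_of_marshall` — **vector form of Marshall's sign
  rule for correlations**: if all amplitudes `c (-1)^{Σ_{z∈A} σ_z} ψ(σ)` are nonnegative reals and
  exactly one of `x ≠ y` lies in `A`, then `Re⟨ψ, 𝐒_x·𝐒_y ψ⟩ ≤ Re⟨ψ, Sᶻ_xSᶻ_y ψ⟩` (every
  spin-flip matrix element of `𝐒_x·𝐒_y` is `≥ 0` and joins configurations of opposite Marshall
  sign; Marshall 1955, Lieb–Mattis 1962, proof of Thm 2);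
* `LiebMattis.re_groundStateFunctional_spinDot_le` — the same for the (unique) ground state:
  `Re ω₀(𝐒_x·𝐒_y) ≤ Re ω₀(Sᶻ_xSᶻ_y)`;
* on the even torus `(ℤ/Lℤ)^d` (sublattices = parity classes):
  `groundStateSpinCorrTorus_nonpos_of_parity_ne` — **`⟨𝐒_x·𝐒_y⟩₀ ≤ 0` whenever `x`, `y` have
  opposite parity** (with isotropy: `G ≤ G/3`); `sum_sum_groundStateSpinCorrTorus_eq_zero` — the
  singlet sum rule `Σ_{x,y} ⟨𝐒_x·𝐒_y⟩₀ = 0`; and the consequence used by the Hubbard-ladder cell,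
  `neelSum_groundStateSpinCorrTorus_ge` — **the energy floor on the Néel sum**
  `Σ_{x,y} ε_xε_y ⟨𝐒_x·𝐒_y⟩₀ ≥ -4 E₀(L)` for `L ≥ 4` even (`E₀(L) < 0` the ground-state energy at
  `J = 1`): `Σ ε_xε_y G = Σ G - 2Σ_{opposite parity} G = -2Σ_{opposite} G ≥ -2Σ_x Σ_{y ∼ x} G`
  `= -4E₀`,
  since the `2d` neighbours of `x` have opposite parity and every opposite-parity term is `≤ 0`.
  Dividing by `L^{2d}` this is a LOWER bound `m_s²(L) ≥ 4|E₀(L)|/L^{2d}` on the finite-volume Néel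
  order parameter from any certified upper bound on the ground-state energy.

## References
* W. Marshall, Proc. Roy. Soc. A 232 (1955) 48–68 (the sign rule). [Marshall1955]
* E. Lieb, D. Mattis, J. Math. Phys. 3 (1962) 749–751, Theorem 2 and its proof (sign rule for
  general spin and bipartite graphs; singlet ground state for `|A| = |Aᶜ|`). [LiebMattis1962]
* T. Kennedy, E. H. Lieb, B. S. Shastry, J. Stat. Phys. 53 (1988) 1019–1030, p. 1021 and eq. (3)
  (isotropy, the energy sum rule `⟨S³_0S³_δ⟩ = -e₀/3d`). [KLS1988JSP]
* A. Auerbach, *Interacting Electrons and Quantum Magnetism* (1994), Thm 5.1–5.2, eqs. (5.12)–(5.13)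
  (Marshall's theorem: positivity of the rotated amplitudes, singlet). [Auerbach1994]
-/

noncomputable section

open Matrix Finset
open scoped ComplexOrder BigOperators ComplexConjugate

namespace Literature.MathematicalPhysics.QuantumLattice

/-! ### Marshall's sign rule for correlations: vector level, general graph -/

namespace LiebMattis

variable {Λ : Type*} [Fintype Λ] [DecidableEq Λ] (n : ℕ)

/-- `Sᶻ_x Sᶻ_y` is diagonal in the product basis, with entries `(n/2 - σ_x)(n/2 - σ_y)`.
[folklore] -/
private theorem onSite_spinZ_mul_onSite_spinZ_eq_diagonal (x y : Λ) :
    (onSite x (SpinOperators.spinZ n) * onSite y (SpinOperators.spinZ n) : Op Λ (n + 1)) =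
      diagonal fun σ => ((n : ℂ) / 2 - ((σ x : ℕ) : ℂ)) * ((n : ℂ) / 2 - ((σ y : ℕ) : ℂ)) := by
  rw [SpinOperators.spinZ, onSite_diagonal, onSite_diagonal, diagonal_mul_diagonal]

/-- One off-diagonal term of `⟨ψ, 𝐒_x·𝐒_y ψ⟩` for a Marshall-positive vector has nonpositive real
part: the matrix element is a nonnegative real, nonzero only on a hop, and a hop across the
sublattice boundary flips the Marshall sign. [folklore] -/
private theorem re_offDiag_term_nonpos {x y : Λ} (hxy : x ≠ y) (A : Finset Λ) (hA : x ∈ A ↔ y ∉ A)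
    {ψ : TensorIndex Λ (n + 1) → ℂ} {c : ℂ} (hc : c ≠ 0)
    (hpos : ∀ σ, 0 ≤ (c * marshallSign A σ * ψ σ).re ∧ (c * marshallSign A σ * ψ σ).im = 0)
    {σ τ : TensorIndex Λ (n + 1)} (hστ : σ ≠ τ) :
    (star (ψ σ) * (spinDot n x y σ τ * ψ τ)).re ≤ 0 := by
  have hA' : y ∈ A ↔ x ∉ A :=
    ⟨fun hy hx => (hA.1 hx) hy, fun hx => by by_contra hy; exact hx (hA.2 hy)⟩
  obtain ⟨t, ht, ht0⟩ := spinDot_apply_eq_real n hxy σ τ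
  have ht0 : 0 ≤ t := ht0 hστ
  by_cases hz : spinDot n x y σ τ = 0
  · rw [hz, zero_mul, mul_zero, Complex.zero_re]
  have hm : marshallSign A σ * marshallSign A τ = -1 := by
    rcases hop_of_spinDot_apply_ne_zero n hxy hστ hz with ⟨hx, hy, hrest⟩ | ⟨hy, hx, hrest⟩
    · exact marshallSign_mul_marshallSign_of_hop A hA hx hy hrest
    · exact marshallSign_mul_marshallSign_of_hop A hA' hy hx hrest
  obtain ⟨hσre, hσim⟩ := hpos σ
  obtain ⟨hτre, hτim⟩ := hpos τ
  obtain ⟨a, ha, ha0⟩ : ∃ a : ℝ, c * marshallSign A σ * ψ σ = a ∧ 0 ≤ a :=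
    ⟨_, Complex.ext (by rw [Complex.ofReal_re]) (by rw [Complex.ofReal_im, hσim]), hσre⟩
  obtain ⟨b, hb, hb0⟩ : ∃ b : ℝ, c * marshallSign A τ * ψ τ = b ∧ 0 ≤ b :=
    ⟨_, Complex.ext (by rw [Complex.ofReal_re]) (by rw [Complex.ofReal_im, hτim]), hτre⟩
  -- `conj(ψ σ) · t · ψ τ · |c|² = -(a t b)`
  have hid : star (ψ σ) * ((t : ℂ) * ψ τ) * (star c * c) =
      -(star (c * marshallSign A σ * ψ σ) * (t : ℂ) * (c * marshallSign A τ * ψ τ)) := by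
    rw [star_mul', star_mul', star_marshallSign]
    linear_combination (star (ψ σ) * (t : ℂ) * ψ τ * star c * c) * hm
  have hstar_a : star (a : ℂ) = a := by rw [← starRingEnd_apply, Complex.conj_ofReal]
  have hcc : star c * c = ((Complex.normSq c : ℝ) : ℂ) := by
    rw [Complex.normSq_eq_conj_mul_self]; rfl
  rw [ha, hb, hstar_a, hcc,
    show ((a : ℂ) * (t : ℂ) * (b : ℂ)) = ((a * t * b : ℝ) : ℂ) by push_cast; ring] at hid
  have hre := congrArg Complex.re hid
  rw [Complex.re_mul_ofReal, Complex.neg_re, Complex.ofReal_re] at hre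
  rw [ht]
  have hN : 0 < Complex.normSq c := Complex.normSq_pos.2 hc
  have hatb : 0 ≤ a * t * b := by positivity
  by_contra hX
  rw [not_le] at hX
  have := mul_pos hX hN
  linarith

/-- **Marshall's sign rule for correlations (vector form).** If `x ≠ y` lie on opposite sides of
the sublattice `A` and every amplitude `c (-1)^{Σ_{z∈A} σ_z} ψ(σ)` (`c ≠ 0` fixed) is a nonnegative
real, then `Re⟨ψ, 𝐒_x·𝐒_y ψ⟩ ≤ Re⟨ψ, Sᶻ_x Sᶻ_y ψ⟩`: the spin-flip part `½(S⁺_xS⁻_y + S⁻_xS⁺_y)`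
has nonnegative matrix elements joining configurations of opposite Marshall sign. Marshall (1955);
Lieb–Mattis (1962), proof of Thm 2; Auerbach (1994) Thm 5.1, eq. (5.12).
[cite: LiebMattis1962, Theorem 2] [cite: Marshall1955, sign rule] -/
theorem re_dotProduct_spinDot_mulVec_le_of_marshall {x y : Λ} (hxy : x ≠ y) (A : Finset Λ)
    (hA : x ∈ A ↔ y ∉ A) {ψ : TensorIndex Λ (n + 1) → ℂ} {c : ℂ} (hc : c ≠ 0)
    (hpos : ∀ σ, 0 ≤ (c * marshallSign A σ * ψ σ).re ∧ (c * marshallSign A σ * ψ σ).im = 0) :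
    (star ψ ⬝ᵥ (spinDot n x y *ᵥ ψ)).re ≤
      (star ψ ⬝ᵥ
        ((onSite x (SpinOperators.spinZ n) * onSite y (SpinOperators.spinZ n)) *ᵥ ψ)).re := by
  have hL : star ψ ⬝ᵥ (spinDot n x y *ᵥ ψ) =
      ∑ σ, star (ψ σ) * ∑ τ, spinDot n x y σ τ * ψ τ := by
    simp only [dotProduct, mulVec, Pi.star_apply]
  have hR : star ψ ⬝ᵥ ((onSite x (SpinOperators.spinZ n) * onSite y (SpinOperators.spinZ n)) *ᵥ ψ) =
      ∑ σ, star (ψ σ) *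
        ((((n : ℂ) / 2 - ((σ x : ℕ) : ℂ)) * ((n : ℂ) / 2 - ((σ y : ℕ) : ℂ))) * ψ σ) := by
    rw [onSite_spinZ_mul_onSite_spinZ_eq_diagonal]
    simp only [dotProduct, mulVec_diagonal, Pi.star_apply]
  rw [hL, hR, Complex.re_sum, Complex.re_sum]
  refine Finset.sum_le_sum fun σ _ => ?_
  rw [Finset.mul_sum, Complex.re_sum, ← Finset.add_sum_erase _ _ (Finset.mem_univ σ),
    spinDot_apply_self n hxy σ]
  have hoff : ∑ τ ∈ Finset.univ.erase σ, (star (ψ σ) * (spinDot n x y σ τ * ψ τ)).re ≤ 0 :=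
    Finset.sum_nonpos fun τ hτ =>
      re_offDiag_term_nonpos n hxy A hA hc hpos (Finset.ne_of_mem_erase hτ).symm
  linarith

/-! ### The ground state of the balanced bipartite antiferromagnet -/

variable (G : SimpleGraph Λ) [DecidableRel G.Adj] (A : Finset Λ) (J : ℝ)

/-- **Marshall's sign rule for ground-state correlations.** For the Heisenberg antiferromagnet
(`J > 0`) on a connected graph bipartite in `A`, `Aᶜ` with `|A| = |Aᶜ|`, and `x ≠ y` on opposite
sublattices, `Re ω₀(𝐒_x·𝐒_y) ≤ Re ω₀(Sᶻ_x Sᶻ_y)` in the (unique, tracial = vector) ground state.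
Marshall (1955); Lieb–Mattis (1962) Thm 2 (sign rule and uniqueness); Auerbach (1994) Thm 5.1.
[cite: LiebMattis1962, Theorem 2] [cite: Marshall1955, sign rule] -/
theorem re_groundStateFunctional_spinDot_le (hG : G.Connected)
    (hA : G.IsBipartiteWith (A : Set Λ) (↑A)ᶜ) (hJ : 0 < J) (hcard : Aᶜ.card = A.card)
    {x y : Λ} (hxy : x ≠ y) (hxA : x ∈ A ↔ y ∉ A) :
    ((heisenbergHamiltonian n G J).groundStateFunctional (spinDot n x y)).re ≤
      ((heisenbergHamiltonian n G J).groundStateFunctional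
        (onSite x (SpinOperators.spinZ n) * onSite y (SpinOperators.spinZ n))).re := by
  have hHerm := heisenbergHamiltonian_isHermitian n G J
  obtain ⟨ψ, hψ, hψ0⟩ :=
    Submodule.exists_mem_ne_zero_of_ne_bot (Matrix.groundSpace_ne_bot_holds hHerm)
  have hU := hasUniqueGroundState_of_card_compl_eq n G A J hG hA hJ hcard
  obtain ⟨hK, c, hc, hpos⟩ := groundState_mem_sector_and_marshall n G A J hG hA hJ hcard hψ hψ0
  have hsupp := (mem_spinZSector_weight_iff (n := n) (Aᶜ.card * n) ψ).1 hK
  have hpos' : ∀ σ, 0 ≤ (c * marshallSign A σ * ψ σ).re ∧ (c * marshallSign A σ * ψ σ).im = 0 := by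
    intro σ
    by_cases hw : (∑ z, (σ z : ℕ)) = Aᶜ.card * n
    · exact ⟨(hpos σ hw).1.le, (hpos σ hw).2⟩
    · rw [hsupp σ hw, mul_zero]
      simp
  have hvec := re_dotProduct_spinDot_mulVec_le_of_marshall n hxy A hxA hc hpos'
  have hnorm : 0 < star ψ ⬝ᵥ ψ := Matrix.dotProduct_star_self_pos_iff.2 hψ0
  obtain ⟨hre, him⟩ := Complex.pos_iff.1 hnorm
  have hr : star ψ ⬝ᵥ ψ = (((star ψ ⬝ᵥ ψ).re : ℝ) : ℂ) :=
    Complex.ext (by rw [Complex.ofReal_re]) (by rw [Complex.ofReal_im, ← him])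
  rw [groundStateFunctional_eq_of_hasUniqueGroundState hU hψ hψ0,
    groundStateFunctional_eq_of_hasUniqueGroundState hU hψ hψ0, hr, Complex.div_ofReal_re,
    Complex.div_ofReal_re]
  exact div_le_div_of_nonneg_right hvec hre.le

end LiebMattis

/-! ### The even torus: opposite-parity correlations are nonpositive; the Néel-sum floor -/

section Torus

open Literature.Probability.LatticeModels

variable {d : ℕ}

/-- Opposite parities put `x`, `y` on opposite sides of the even sublattice. [folklore] -/
private theorem mem_evenSublattice_iff_not_mem_of_parity_ne {L : ℕ} [NeZero L] (hL : 2 ∣ L)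
    {x y : TorusSite d L} (hxy : torusSiteParity hL x ≠ torusSiteParity hL y) :
    x ∈ evenSublattice (d := d) L hL ↔ y ∉ evenSublattice (d := d) L hL := by
  have h01 : ∀ t : ZMod 2, t = 0 ∨ t = 1 := by decide
  rw [mem_evenSublattice_iff, mem_evenSublattice_iff]
  constructor
  · intro hx hy
    exact hxy (hx.trans hy.symm)
  · intro hy
    rcases h01 (torusSiteParity hL x) with hx | hx
    · exact hx
    · exfalso
      rcases h01 (torusSiteParity hL y) with hy' | hy'
      · exact hy hy'
      · exact hxy (hx.trans hy'.symm)

/-- **Marshall's sign rule on the even torus**: in the ground state of the spin-`n/2` Heisenberg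
antiferromagnet (`J > 0`) on `(ℤ/Lℤ)^d`, `L` even, `d ≥ 1`, the correlation `⟨𝐒_x·𝐒_y⟩₀` is
nonpositive whenever `x` and `y` have opposite parity (sign rule `Re ω₀(𝐒_x·𝐒_y) ≤ Re ω₀(Sᶻ_xSᶻ_y)`
combined with isotropy `⟨𝐒_x·𝐒_y⟩₀ = 3⟨Sᶻ_xSᶻ_y⟩₀`). Marshall (1955); Lieb–Mattis (1962) Thm 2;
Kennedy–Lieb–Shastry (1988) p. 1021 (isotropy). [cite: LiebMattis1962, Theorem 2]
[cite: KLS1988JSP, p. 1021] -/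
theorem groundStateSpinCorrTorus_nonpos_of_parity_ne (L : ℕ) [NeZero L] (hL : 2 ∣ L) (i : Fin d)
    (n : ℕ) {J : ℝ} (hJ : 0 < J) {x y : TorusSite d L}
    (hxy : torusSiteParity hL x ≠ torusSiteParity hL y) :
    groundStateSpinCorrTorus L n J x y ≤ 0 := by
  have hne : x ≠ y := fun h => hxy (h ▸ rfl)
  have hxA := mem_evenSublattice_iff_not_mem_of_parity_ne hL hxy
  have hG := torusGraph_connected_of_proj d L
  have hbip := torusGraph_isBipartiteWith_evenSublattice (d := d) L hL
  have hcard := card_compl_evenSublattice (d := d) L hL i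
  rw [groundStateSpinCorrTorus_eq_sum L n hJ, ← groundStateSpinCorrTorus_eq_sum L n one_pos]
  have h1 : groundStateSpinCorrTorus L n 1 x y =
      ((heisenbergTorus d L n 1).groundStateFunctional (spinDot n x y)).re := by
    rw [groundStateSpinCorrTorus_of_neZero, ← map_sum, ← spinDot_eq_sum_mul_of_ne n hne]
  have h2 : groundStateSpinCorrTorus L n 1 x y =
      3 * ((heisenbergTorus d L n 1).groundStateFunctional
        (onSite x (SpinOperators.spinZ n) * onSite y (SpinOperators.spinZ n))).re := by
    rw [groundStateSpinCorrTorus_one_eq_three_mul, ← heisGroundCorr_eq_zero_comp 2,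
      heisGroundCorr_of_neZero]
    rfl
  have h3 : ((heisenbergTorus d L n 1).groundStateFunctional (spinDot n x y)).re ≤
      ((heisenbergTorus d L n 1).groundStateFunctional
        (onSite x (SpinOperators.spinZ n) * onSite y (SpinOperators.spinZ n))).re :=
    LiebMattis.re_groundStateFunctional_spinDot_le n (torusGraph d L) _ 1 hG hbip one_pos hcard
      hne hxA
  linarith

/-- **Singlet sum rule on the even torus**: `Σ_{x,y} ⟨𝐒_x·𝐒_y⟩₀ = ω₀((𝐒_tot)²) = 0` (`d ≥ 1`,
`L` even, `J > 0`). Lieb–Mattis (1962) Thm 2. [cite: LiebMattis1962, Theorem 2] -/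
theorem sum_sum_groundStateSpinCorrTorus_eq_zero (L : ℕ) [NeZero L] (hL : 2 ∣ L) (i : Fin d)
    (n : ℕ) {J : ℝ} (hJ : 0 < J) :
    ∑ x : TorusSite d L, ∑ y : TorusSite d L, groundStateSpinCorrTorus L n J x y = 0 := by
  have hG := torusGraph_connected_of_proj d L
  have hbip := torusGraph_isBipartiteWith_evenSublattice (d := d) L hL
  have hcard := card_compl_evenSublattice (d := d) L hL i
  -- the ground state is a singlet (Lieb–Mattis: `S₀ = |(|A| - |Aᶜ|)| n/2 = 0`, unique ground state)
  have hω : (heisenbergTorus d L n J).groundStateFunctional (totalSpinSq n) = 0 := by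
    have hHerm := heisenbergHamiltonian_isHermitian n (torusGraph d L) J
    obtain ⟨ψ, hψ, hψ0⟩ :=
      Submodule.exists_mem_ne_zero_of_ne_bot (Matrix.groundSpace_ne_bot_holds hHerm)
    have hU := LiebMattis.hasUniqueGroundState_of_card_compl_eq n (torusGraph d L)
      (evenSublattice (d := d) L hL) J hG hbip hJ hcard
    obtain ⟨hspin, -⟩ :=
      marshall_lieb_mattis_spin_holds n (torusGraph d L) (evenSublattice (d := d) L hL) J hG hbip hJ
    have hS0 : liebMattisSpin n (evenSublattice (d := d) L hL) = 0 := by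
      simp [liebMattisSpin, hcard]
    have hGS : (heisenbergTorus d L n J).IsGroundStateVector ψ :=
      (Matrix.isGroundStateVector_iff _ _).2 ⟨hψ0, hψ⟩
    have h := hspin ψ hGS
    simp only [hS0, zero_mul, Complex.ofReal_zero, zero_smul] at h
    rw [groundStateFunctional_eq_of_hasUniqueGroundState hU hψ hψ0, h, dotProduct_zero, zero_div]
  have hexp : (totalSpinSq n : Op (TorusSite d L) (n + 1)) =
      ∑ x : TorusSite d L, ∑ y : TorusSite d L, ∑ α : Fin 3, siteSpin n x α * siteSpin n y α := by
    simp only [totalSpinSq, totalSpin, Finset.sum_mul_sum]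
    rw [Finset.sum_comm]
    exact Finset.sum_congr rfl fun x _ => Finset.sum_comm
  calc ∑ x : TorusSite d L, ∑ y : TorusSite d L, groundStateSpinCorrTorus L n J x y
      = ∑ x : TorusSite d L, ∑ y : TorusSite d L, (∑ α : Fin 3,
          (heisenbergTorus d L n J).groundStateFunctional
            (siteSpin n x α * siteSpin n y α)).re := by
        simp only [groundStateSpinCorrTorus_of_neZero]
    _ = ((heisenbergTorus d L n J).groundStateFunctional (totalSpinSq n)).re := by
        rw [hexp, map_sum, Complex.re_sum]
        refine Finset.sum_congr rfl fun x _ => ?_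
        rw [map_sum, Complex.re_sum]
        refine Finset.sum_congr rfl fun y _ => ?_
        rw [map_sum]
    _ = 0 := by rw [hω, Complex.zero_re]

/-- Symmetry `⟨𝐒_x·𝐒_y⟩₀ = ⟨𝐒_y·𝐒_x⟩₀` (`J > 0`). [folklore] -/
private theorem groundStateSpinCorrTorus_symm' (L n : ℕ) {J : ℝ} (hJ : 0 < J)
    (x y : TorusSite d L) :
    groundStateSpinCorrTorus L n J x y = groundStateSpinCorrTorus L n J y x := by
  rw [groundStateSpinCorrTorus_eq_sum L n hJ, groundStateSpinCorrTorus_eq_sum L n hJ]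
  exact Finset.sum_congr rfl fun α _ => heisGroundCorr_symm α L n x y

/-- `⟨𝐒_x·𝐒_y⟩₀ = 3 G⁰(x,y)` for `J > 0`. [folklore] -/
private theorem groundStateSpinCorrTorus_eq_three_mul' (L n : ℕ) {J : ℝ} (hJ : 0 < J)
    (x y : TorusSite d L) :
    groundStateSpinCorrTorus L n J x y = 3 * heisGroundCorr 0 L n x y := by
  rw [groundStateSpinCorrTorus_eq_sum L n hJ, ← groundStateSpinCorrTorus_eq_sum L n one_pos,
    groundStateSpinCorrTorus_one_eq_three_mul]

/-- The energy sum rule over the directed bonds `(x, x + eᵢ)`: `Σ_x Σ_i ⟨𝐒_x·𝐒_{x+eᵢ}⟩₀ = E₀(L)`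
(`L ≥ 3`, `J > 0` for the correlations, energy at `J = 1`). [folklore] -/
private theorem sum_sum_groundStateSpinCorrTorus_single (L : ℕ) [NeZero L] (hL3 : 3 ≤ L) (n : ℕ)
    {J : ℝ} (hJ : 0 < J) :
    ∑ x : TorusSite d L, ∑ i : Fin d, groundStateSpinCorrTorus L n J x (x + Pi.single i 1) =
      (heisenbergTorus d L n 1).groundEnergy := by
  simp_rw [groundStateSpinCorrTorus_eq_three_mul' L n hJ]
  rw [groundEnergy_heisenbergTorus_eq, sum_edgeFinset_torusGraph hL3, Finset.mul_sum]
  refine Finset.sum_congr rfl fun x _ => ?_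
  rw [Finset.mul_sum]
  rfl

/-- The same over the directed bonds `(x, x - eᵢ)` (translation `x ↦ x + eᵢ` and symmetry).
[folklore] -/
private theorem sum_sum_groundStateSpinCorrTorus_sub_single (L : ℕ) [NeZero L] (hL3 : 3 ≤ L)
    (n : ℕ) {J : ℝ} (hJ : 0 < J) :
    ∑ x : TorusSite d L, ∑ i : Fin d, groundStateSpinCorrTorus L n J x (x - Pi.single i 1) =
      (heisenbergTorus d L n 1).groundEnergy := by
  rw [← sum_sum_groundStateSpinCorrTorus_single L hL3 n hJ]
  calc ∑ x : TorusSite d L, ∑ i : Fin d, groundStateSpinCorrTorus L n J x (x - Pi.single i 1)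
      = ∑ i : Fin d, ∑ x : TorusSite d L, groundStateSpinCorrTorus L n J x (x - Pi.single i 1) :=
        Finset.sum_comm
    _ = ∑ i : Fin d, ∑ x : TorusSite d L, groundStateSpinCorrTorus L n J x (x + Pi.single i 1) := by
        refine Finset.sum_congr rfl fun i _ => ?_
        refine (Fintype.sum_equiv (Equiv.subRight (Pi.single i 1)) _
          (fun y => groundStateSpinCorrTorus L n J (y + Pi.single i 1) y) fun x => ?_).trans ?_
        · simp only [Equiv.subRight_apply, sub_add_cancel]
        · exact Finset.sum_congr rfl fun y _ => groundStateSpinCorrTorus_symm' L n hJ _ _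
    _ = ∑ x : TorusSite d L, ∑ i : Fin d, groundStateSpinCorrTorus L n J x (x + Pi.single i 1) :=
        Finset.sum_comm

/-- The `2d` neighbours of `x` have opposite parity and are distinct (`L ≥ 3`), so the sum of the
(nonpositive) opposite-parity correlations of `x` is at most the sum over its neighbours.
[folklore] -/
private theorem sum_ite_parity_le_sum_neighbours (L : ℕ) [NeZero L] (hL : 2 ∣ L) (hL3 : 3 ≤ L)
    (i₀ : Fin d) (n : ℕ) {J : ℝ} (hJ : 0 < J) (x : TorusSite d L) :
    (∑ y : TorusSite d L,
        if torusSiteParity hL x ≠ torusSiteParity hL y then groundStateSpinCorrTorus L n J x y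
        else 0) ≤
      (∑ i : Fin d, groundStateSpinCorrTorus L n J x (x + Pi.single i 1)) +
        ∑ i : Fin d, groundStateSpinCorrTorus L n J x (x - Pi.single i 1) := by
  classical
  have hL2 : 2 ≤ L := by omega
  have hflip : ∀ t : ZMod 2, t ≠ t + 1 := by decide
  set T : Finset (TorusSite d L) :=
    Finset.univ.filter fun y => torusSiteParity hL x ≠ torusSiteParity hL y with hT
  set Np : Finset (TorusSite d L) := Finset.univ.image fun i : Fin d => x + Pi.single i 1 with hNp
  set Nm : Finset (TorusSite d L) := Finset.univ.image fun i : Fin d => x - Pi.single i 1 with hNm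
  have hinjp : Function.Injective fun i : Fin d => x + (Pi.single i 1 : TorusSite d L) :=
    fun i j h => torus_single_injective hL2 (add_left_cancel h)
  have hinjm : Function.Injective fun i : Fin d => x - (Pi.single i 1 : TorusSite d L) :=
    fun i j h => torus_single_injective hL2 (sub_right_injective h)
  have hdisj : Disjoint Np Nm := by
    rw [Finset.disjoint_left]
    intro y hyp hym
    rw [hNp, Finset.mem_image] at hyp
    rw [hNm, Finset.mem_image] at hym
    obtain ⟨i, -, rfl⟩ := hyp
    obtain ⟨j, -, hj⟩ := hym
    have h0 : (Pi.single i 1 : TorusSite d L) + Pi.single j 1 = 0 := by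
      have := congrArg (fun z => z - x + Pi.single j 1) hj
      simpa [add_comm, add_left_comm, sub_eq_add_neg] using this.symm
    exact torus_single_add_single_ne_zero hL3 i j h0
  have hsub : Np ∪ Nm ⊆ T := by
    intro y hy
    rw [hT, Finset.mem_filter]
    refine ⟨Finset.mem_univ _, ?_⟩
    rcases Finset.mem_union.1 hy with hy | hy
    · rw [hNp, Finset.mem_image] at hy
      obtain ⟨i, -, rfl⟩ := hy
      rw [torusSiteParity_add_single]
      exact hflip _
    · rw [hNm, Finset.mem_image] at hy
      obtain ⟨i, -, rfl⟩ := hy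
      have h := torusSiteParity_add_single hL (x - Pi.single i 1) i
      rw [sub_add_cancel] at h
      rw [h]
      exact fun h' => hflip _ h'.symm
  have hT' : (∑ y : TorusSite d L,
      if torusSiteParity hL x ≠ torusSiteParity hL y then groundStateSpinCorrTorus L n J x y
      else 0) = ∑ y ∈ T, groundStateSpinCorrTorus L n J x y := by
    rw [hT, Finset.sum_filter]
  have hrest : ∑ y ∈ T \ (Np ∪ Nm), groundStateSpinCorrTorus L n J x y ≤ 0 := by
    refine Finset.sum_nonpos fun y hy => ?_
    have hyT := (Finset.mem_sdiff.1 hy).1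
    rw [hT, Finset.mem_filter] at hyT
    exact groundStateSpinCorrTorus_nonpos_of_parity_ne L hL i₀ n hJ hyT.2
  rw [hT', ← Finset.sum_sdiff hsub, Finset.sum_union hdisj, hNp, hNm,
    Finset.sum_image fun i _ j _ h => hinjp h, Finset.sum_image fun i _ j _ h => hinjm h]
  linarith

/-- **The energy floor on the Néel sum (Marshall sign rule + singlet sum rule + energy sum rule).**
For the spin-`n/2` Heisenberg antiferromagnet on the even torus `(ℤ/Lℤ)^d`, `L ≥ 4` even, `d ≥ 1`,
and any sublattice sign `s = +1` on the even sublattice, `-1` on the odd one: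
`Σ_{x,y} s_x s_y ⟨𝐒_x·𝐒_y⟩₀ ≥ -4 E₀(L)`, where `E₀(L) = groundEnergy (heisenbergTorus d L n 1) < 0`
(`Σ s_xs_y G = Σ G - 2Σ_{opposite parity} G`, `Σ G = 0` (singlet), and for each `x` the
opposite-parity terms are `≤ 0` (Marshall) and include its `2d` neighbours, whose directed-bond sums
give `2E₀` (KLS eq. (3))). Consequently `m_s²(L) = L^{-2d} Σ s_xs_y G ≥ 4|E₀(L)|/L^{2d}`.
[cite: LiebMattis1962, Theorem 2] [cite: KLS1988JSP, eq. (3)] [cite: Marshall1955, sign rule] -/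
theorem neelSum_groundStateSpinCorrTorus_ge (L : ℕ) [NeZero L] (hL : 2 ∣ L) (hL3 : 3 ≤ L)
    (i₀ : Fin d) (n : ℕ) {J : ℝ} (hJ : 0 < J) (s : TorusSite d L → ℝ)
    (hs₁ : ∀ x, x ∈ evenSublattice (d := d) L hL → s x = 1)
    (hs₂ : ∀ x, x ∉ evenSublattice (d := d) L hL → s x = -1) :
    -4 * (heisenbergTorus d L n 1).groundEnergy ≤
      ∑ x : TorusSite d L, ∑ y : TorusSite d L, s x * s y * groundStateSpinCorrTorus L n J x y := by
  classical
  -- `s x * s y = 1 - 2·[parity differs]`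
  have hss : ∀ x y : TorusSite d L, s x * s y * groundStateSpinCorrTorus L n J x y =
      groundStateSpinCorrTorus L n J x y -
        2 * (if torusSiteParity hL x ≠ torusSiteParity hL y then groundStateSpinCorrTorus L n J x y
          else 0) := by
    intro x y
    by_cases hx : x ∈ evenSublattice (d := d) L hL <;>
      by_cases hy : y ∈ evenSublattice (d := d) L hL
    · have hp : torusSiteParity hL x = torusSiteParity hL y := by
        rw [(mem_evenSublattice_iff L hL x).1 hx, (mem_evenSublattice_iff L hL y).1 hy]
      rw [hs₁ x hx, hs₁ y hy, if_neg (not_not.2 hp)]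
      ring
    · have hp : torusSiteParity hL x ≠ torusSiteParity hL y := fun h =>
        hy ((mem_evenSublattice_iff L hL y).2 (h ▸ (mem_evenSublattice_iff L hL x).1 hx))
      rw [hs₁ x hx, hs₂ y hy, if_pos hp]
      ring
    · have hp : torusSiteParity hL x ≠ torusSiteParity hL y := fun h =>
        hx ((mem_evenSublattice_iff L hL x).2 (h.symm ▸ (mem_evenSublattice_iff L hL y).1 hy))
      rw [hs₂ x hx, hs₁ y hy, if_pos hp]
      ring
    · have hp : torusSiteParity hL x = torusSiteParity hL y := by
        have h01 : ∀ t : ZMod 2, t ≠ 0 → t = 1 := by decide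
        rw [h01 _ (fun h => hx ((mem_evenSublattice_iff L hL x).2 h)),
          h01 _ (fun h => hy ((mem_evenSublattice_iff L hL y).2 h))]
      rw [hs₂ x hx, hs₂ y hy, if_neg (not_not.2 hp)]
      ring
  simp_rw [hss, Finset.sum_sub_distrib, ← Finset.mul_sum]
  rw [sum_sum_groundStateSpinCorrTorus_eq_zero L hL i₀ n hJ, zero_sub]
  have hle : ∑ x : TorusSite d L, ∑ y : TorusSite d L,
      (if torusSiteParity hL x ≠ torusSiteParity hL y then groundStateSpinCorrTorus L n J x y
        else 0) ≤ 2 * (heisenbergTorus d L n 1).groundEnergy := by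
    calc ∑ x : TorusSite d L, ∑ y : TorusSite d L,
          (if torusSiteParity hL x ≠ torusSiteParity hL y then groundStateSpinCorrTorus L n J x y
            else 0)
        ≤ ∑ x : TorusSite d L,
            ((∑ i : Fin d, groundStateSpinCorrTorus L n J x (x + Pi.single i 1)) +
              ∑ i : Fin d, groundStateSpinCorrTorus L n J x (x - Pi.single i 1)) :=
          Finset.sum_le_sum fun x _ => sum_ite_parity_le_sum_neighbours L hL hL3 i₀ n hJ x
      _ = 2 * (heisenbergTorus d L n 1).groundEnergy := by
          rw [Finset.sum_add_distrib, sum_sum_groundStateSpinCorrTorus_single L hL3 n hJ,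
            sum_sum_groundStateSpinCorrTorus_sub_single L hL3 n hJ]
          ring
  linarith

end Torus

end Literature.MathematicalPhysics.QuantumLattice
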